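import Mathlib
import Summits.SmoothPoincare4.SmoothPoincare4.Theorems.SoloInformedBinaryIcosahedralData

/-!
# The binary icosahedral input of the Poincaré-sphere trick, I: structure of `I* = SL(2, 𝔽₅)`

Solo residency `solo-SmoothPoincare4-informed`, session 109 (HOME `paper/paper.md`, Part I:
Lemma 2.2′ and Lemma `T_P`(a) = §3.2(a); CLAIMS C719–C723).

`SoloInformedSectionSurgery` proved the ALGEBRAIC CORE of loop surgery on a mapping torus in
abstract form: for a nontrivial perfect group `G` all of whose normal subgroups are central or
everything, the normal closure of the commutators `⁅y, g⁆` (`y ∈ G`) — the subgroup killed by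
surgery on `F × S¹` along a section-like loop of class `(g, 1)` — is all of `G` iff `g` is not
central.  The paper applies this to the Poincaré homology sphere `P = S³/I*`, `G = π₁ P = I*`, the
binary icosahedral group, in its standard model `SL(2, 𝔽₅)` (`SoloInformedBinaryIcosahedralData`).
This file proves, as KERNEL facts about the concrete group `SL(2, ZMod 5)`, the structural input:

* `mem_elemList`, `card_eq` — the explicit enumeration is complete (`|SL(2, 𝔽₅)| = 120`); through
  it every universally quantified statement below is a finite kernel computation, always stated
  as `List.all … = true` over an explicit list and closed by `decide +kernel` (a bounded `∀` over
  the `Fintype` would make instance resolution enumerate `120^k` tuples; no `native_decide`);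
* `x_sq`, `y_pow_three`, `z_pow_five`, `x_mul_y_mul_z`, `orderOf_x/y/z` — `x² = y³ = z⁵ = xyz = -1`,
  orders `4, 6, 10`: the binary polyhedral data of type `(2,3,5)`;
* `mem_center_iff` — the centre is `{1, -1}`;
* `closure_xy_eq_top`, `eq_top_of_mem` — `x, y` generate;
* `commutator_eq_top` — `I*` is PERFECT (`x`, `y` are commutators);
* `exists_rep_isConj` — CLASS EXHAUSTION (paper §3.2(a)): every non-central element is conjugate
  to one of `x, y, y², z, z², z³, z⁴` (class sizes `30, 20, 20, 12, 12, 12, 12`); in the paper's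
  wording, to `x^j` (`j` odd), `y^j` (`3 ∤ j`) or `z^j` (`5 ∤ j`) (`isConj_pow_x_or_y_or_z`);
* `normalClosure_singleton_eq_top`, `normal_le_center_or_eq_top` — the normal closure of any
  non-central element is everything; every normal subgroup is central or everything (the proper
  normal subgroups are `1` and `{±1}`).

The sequel `SoloInformedBinaryIcosahedralClasses` adds the `A₅`-orders, the nine conjugacy
classes and the capstone instantiating `SectionSurgery.normalClosure_commutators_eq_top_iff`.
-/

namespace Summit.SmoothPoincare4.SmoothPoincare4.Theorems
namespace BinaryIcosahedral

open Matrix MatrixGroups Subgroup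
open scoped commutatorElement

/-! ### Relations and orders of the generators -/

/-- `x² = -1`. -/
theorem x_sq : x ^ 2 = -1 := by decide
/-- `y³ = -1`. -/
theorem y_pow_three : y ^ 3 = -1 := by decide
/-- `z⁵ = -1`. -/
theorem z_pow_five : z ^ 5 = -1 := by decide +kernel
/-- `x y z = -1`: with the three power relations, the binary polyhedral relations of type
`(2,3,5)`. -/
theorem x_mul_y_mul_z : x * y * z = -1 := by decide
/-- `x` has order `4`. -/
theorem orderOf_x : orderOf x = 4 := by
  rw [orderOf_eq_iff (by norm_num)]
  refine ⟨by decide, fun m hm hm0 => ?_⟩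
  interval_cases m <;> decide
/-- `y` has order `6`. -/
theorem orderOf_y : orderOf y = 6 := by
  rw [orderOf_eq_iff (by norm_num)]
  refine ⟨by decide +kernel, fun m hm hm0 => ?_⟩
  interval_cases m <;> decide +kernel
/-- `z` has order `10`. -/
theorem orderOf_z : orderOf z = 10 := by
  rw [orderOf_eq_iff (by norm_num)]
  refine ⟨by decide +kernel, fun m hm hm0 => ?_⟩
  interval_cases m <;> decide +kernel

/-! ### The enumeration is complete -/

/-- Every residue occurs in `univList`. -/
theorem mem_univList (a : ZMod 5) : a ∈ univList := by
  revert a; decide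

/-- Every quadruple occurs in `allTuples`. -/
theorem mem_allTuples (a b c d : ZMod 5) : (a, b, c, d) ∈ allTuples := by
  simp only [allTuples, List.mem_flatMap, List.mem_map, Prod.mk.injEq]
  exact ⟨a, mem_univList a, b, mem_univList b, c, mem_univList c, d, mem_univList d,
    rfl, rfl, rfl, rfl⟩

/-- `elemList` has `120` entries (and no duplicates, `elemList_nodup`), so `|SL(2, 𝔽₅)| = 120`;
not needed below, recorded for the reader. -/
theorem length_elemList : elemList.length = 120 := by decide +kernel

/-- `elemList` has no duplicates. -/
theorem elemList_nodup : elemList.Nodup := by decide +kernel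

/-- ENUMERATION: every element of `SL(2, ZMod 5)` occurs in `elemList`. -/
theorem mem_elemList (g : SL(2, ZMod 5)) : g ∈ elemList := by
  obtain ⟨A, hA⟩ := g
  have hEta : A = !![A 0 0, A 0 1; A 1 0, A 1 1] := Matrix.eta_fin_two A
  simp only [elemList, List.mem_filterMap]
  refine ⟨(A 0 0, A 0 1, A 1 0, A 1 1), mem_allTuples _ _ _ _, ?_⟩
  have hdet : Matrix.det !![A 0 0, A 0 1; A 1 0, A 1 1] = 1 := by rw [← hEta]; exact hA
  rw [dif_pos hdet]
  simp only [Option.some.injEq]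
  exact Subtype.ext hEta.symm

/-- Reduction of a universally quantified decidable statement to the enumeration. -/
theorem forall_iff_forall_mem {P : SL(2, ZMod 5) → Prop} :
    (∀ g, P g) ↔ ∀ g ∈ elemList, P g :=
  ⟨fun h g _ => h g, fun h g => h g (mem_elemList g)⟩

/-- `|SL(2, 𝔽₅)| = 120`. -/
theorem card_eq : Fintype.card (SL(2, ZMod 5)) = 120 := by
  have h : elemList.toFinset = (Finset.univ : Finset (SL(2, ZMod 5))) :=
    Finset.eq_univ_iff_forall.mpr fun g => List.mem_toFinset.mpr (mem_elemList g)
  rw [← Finset.card_univ, ← h, List.toFinset_card_of_nodup elemList_nodup, length_elemList]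

/-! ### The centre -/

/-- Kernel check over the enumeration: an element commuting with `x` and `y` is `±1`.  (All such
checks are stated as `List.all … = true` so that `decide` evaluates a Boolean over the explicit list
and never enumerates a `Fintype`.) -/
theorem comm_check :
    (elemList.all fun g => decide (g * x = x * g → g * y = y * g → g = 1 ∨ g = -1)) = true := by
  decide +kernel

/-- `1` and `-1` are the only elements commuting with both `x` and `y`. -/
theorem eq_one_or_eq_neg_one_of_comm {g : SL(2, ZMod 5)} (hx : g * x = x * g)
    (hy : g * y = y * g) : g = 1 ∨ g = -1 :=
  of_decide_eq_true (List.all_eq_true.mp comm_check g (mem_elemList g)) hx hy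

/-- The centre of `SL(2, 𝔽₅)` is `{1, -1}`. -/
theorem mem_center_iff (g : SL(2, ZMod 5)) : g ∈ center (SL(2, ZMod 5)) ↔ g = 1 ∨ g = -1 := by
  constructor
  · intro hg
    rw [Subgroup.mem_center_iff] at hg
    exact eq_one_or_eq_neg_one_of_comm (hg x).symm (hg y).symm
  · rintro (rfl | rfl)
    · exact Subgroup.one_mem _
    · rw [Subgroup.mem_center_iff]
      intro h
      rw [mul_neg_one, neg_one_mul]

/-- `-1` is central. -/
theorem neg_one_mem_center : (-1 : SL(2, ZMod 5)) ∈ center (SL(2, ZMod 5)) :=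
  (mem_center_iff _).mpr (Or.inr rfl)

/-- `x` is not central. -/
theorem x_not_mem_center : x ∉ center (SL(2, ZMod 5)) := by
  rw [mem_center_iff]; decide

/-- `y` is not central. -/
theorem y_not_mem_center : y ∉ center (SL(2, ZMod 5)) := by
  rw [mem_center_iff]; decide

/-- `SL(2, 𝔽₅)` is nontrivial (`x ≠ 1`). -/
theorem nontrivial : Nontrivial (SL(2, ZMod 5)) := ⟨⟨x, 1, by decide⟩⟩

/-! ### Generation by `x` and `y` -/

/-- Values of words lie in any subgroup containing `x` and `y`. -/
theorem evalWord_mem (H : Subgroup (SL(2, ZMod 5))) (hx : x ∈ H) (hy : y ∈ H) :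
    ∀ w, evalWord w ∈ H
  | [] => H.one_mem
  | b :: w => by
    unfold evalWord
    refine H.mul_mem ?_ (evalWord_mem H hx hy w)
    cases b
    · exact hy
    · exact hx

/-- Every element is the value of the corresponding word (kernel check: `120` word evaluations;
an equation of lists, decided without any `Fintype` enumeration). -/
theorem map_evalWord_wordList : wordList.map evalWord = elemList := by decide +kernel

/-- GENERATION: `x` and `y` generate `SL(2, 𝔽₅)`. -/
theorem closure_xy_eq_top : Subgroup.closure ({x, y} : Set (SL(2, ZMod 5))) = ⊤ := by
  rw [eq_top_iff]
  intro g _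
  have hg : g ∈ wordList.map evalWord := by rw [map_evalWord_wordList]; exact mem_elemList g
  obtain ⟨w, _, rfl⟩ := List.mem_map.mp hg
  exact evalWord_mem _ (subset_closure (by simp)) (subset_closure (by simp)) w

/-- A subgroup containing `x` and `y` is everything. -/
theorem eq_top_of_mem {H : Subgroup (SL(2, ZMod 5))} (hx : x ∈ H) (hy : y ∈ H) : H = ⊤ := by
  rw [eq_top_iff, ← closure_xy_eq_top, closure_le]
  intro g hg
  simp only [Set.mem_insert_iff, Set.mem_singleton_iff] at hg
  rcases hg with rfl | rfl
  · exact hx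
  · exact hy

/-! ### Perfectness -/

/-- `x` is a commutator. -/
theorem x_eq_commutator : ⁅sl 0 2 2 0, sl 1 4 3 3⁆ = x := by
  rw [commutatorElement_def]; decide

/-- `y` is a commutator. -/
theorem y_eq_commutator : ⁅sl 0 1 4 3, sl 0 2 2 2⁆ = y := by
  rw [commutatorElement_def]; decide

/-- `I* = SL(2, 𝔽₅)` is PERFECT. -/
theorem commutator_eq_top : commutator (SL(2, ZMod 5)) = ⊤ := by
  apply eq_top_of_mem
  · rw [← x_eq_commutator]
    exact commutator_mem_commutator (mem_top _) (mem_top _)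
  · rw [← y_eq_commutator]
    exact commutator_mem_commutator (mem_top _) (mem_top _)

/-! ### Conjugacy classes: exhaustion by the powers of `x`, `y`, `z` -/

/-- Kernel check of the conjugation table: each row `(g, c, r)` has `r ∈ reps` and
`c * r = g * c`. -/
theorem conjTable_check :
    (conjTable.all fun t => decide (t.2.2 ∈ reps ∧ t.2.1 * t.2.2 = t.1 * t.2.1)) = true := by
  decide +kernel

/-- Row-wise reading of `conjTable_check`. -/
theorem conjTable_valid {t : SL(2, ZMod 5) × SL(2, ZMod 5) × SL(2, ZMod 5)} (ht : t ∈ conjTable) :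
    t.2.2 ∈ reps ∧ t.2.1 * t.2.2 = t.1 * t.2.1 :=
  of_decide_eq_true (List.all_eq_true.mp conjTable_check t ht)

/-- Kernel check: the table covers every non-central element. -/
theorem cover_check :
    (elemList.all fun g => decide (g = 1 ∨ g = -1 ∨ g ∈ conjTable.map Prod.fst)) = true := by
  decide +kernel

/-- Every element is `±1` or a first entry of the conjugation table. -/
theorem conjTable_covers (g : SL(2, ZMod 5)) : g = 1 ∨ g = -1 ∨ g ∈ conjTable.map Prod.fst :=
  of_decide_eq_true (List.all_eq_true.mp cover_check g (mem_elemList g))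

/-- CLASS EXHAUSTION (paper §3.2(a)): every non-central element of `SL(2, 𝔽₅)` is conjugate to
one of `x, y, y², z, z², z³, z⁴`. -/
theorem exists_rep_isConj {g : SL(2, ZMod 5)} (hg : g ∉ center (SL(2, ZMod 5))) :
    ∃ r ∈ reps, IsConj r g := by
  rw [mem_center_iff, not_or] at hg
  rcases conjTable_covers g with h | h | h
  · exact absurd h hg.1
  · exact absurd h hg.2
  · obtain ⟨t, ht, rfl⟩ := List.mem_map.mp h
    obtain ⟨hr, hc⟩ := conjTable_valid ht
    refine ⟨t.2.2, hr, isConj_iff.mpr ⟨t.2.1, ?_⟩⟩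
    rw [hc, mul_inv_cancel_right]

/-- Unfolding `r ∈ reps`. -/
theorem mem_reps_iff {r : SL(2, ZMod 5)} :
    r ∈ reps ↔ r = x ∨ r = y ∨ r = y ^ 2 ∨ r = z ∨ r = z ^ 2 ∨ r = z ^ 3 ∨ r = z ^ 4 := by
  simp only [reps, List.mem_cons, List.not_mem_nil, or_false]

/-- The paper's wording of class exhaustion: every non-central element is conjugate to `x^j` with
`j` odd, or to `y^j` with `3 ∤ j`, or to `z^j` with `5 ∤ j`. -/
theorem isConj_pow_x_or_y_or_z {g : SL(2, ZMod 5)} (hg : g ∉ center (SL(2, ZMod 5))) :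
    (∃ j : ℕ, ¬ 2 ∣ j ∧ IsConj (x ^ j) g) ∨ (∃ j : ℕ, ¬ 3 ∣ j ∧ IsConj (y ^ j) g) ∨
      (∃ j : ℕ, ¬ 5 ∣ j ∧ IsConj (z ^ j) g) := by
  obtain ⟨r, hr, hc⟩ := exists_rep_isConj hg
  rw [mem_reps_iff] at hr
  rcases hr with rfl | rfl | rfl | rfl | rfl | rfl | rfl
  · exact Or.inl ⟨1, by decide, by simpa using hc⟩
  · exact Or.inr (Or.inl ⟨1, by decide, by simpa using hc⟩)
  · exact Or.inr (Or.inl ⟨2, by decide, hc⟩)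
  · exact Or.inr (Or.inr ⟨1, by decide, by simpa using hc⟩)
  · exact Or.inr (Or.inr ⟨2, by decide, hc⟩)
  · exact Or.inr (Or.inr ⟨3, by decide, hc⟩)
  · exact Or.inr (Or.inr ⟨4, by decide, hc⟩)

/-! ### Normal subgroups: central or everything -/

/-- Conjugates of `r` lie in the normal closure of `{r}`. -/
theorem conj_mem_normalClosure (c r : SL(2, ZMod 5)) :
    c * r * c⁻¹ ∈ normalClosure ({r} : Set (SL(2, ZMod 5))) :=
  (normalClosure_normal (s := {r})).conj_mem r (subset_normalClosure (Set.mem_singleton r)) c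

/-- Conjugates of `r⁻¹` lie in the normal closure of `{r}`. -/
theorem conj_inv_mem_normalClosure (c r : SL(2, ZMod 5)) :
    c * r⁻¹ * c⁻¹ ∈ normalClosure ({r} : Set (SL(2, ZMod 5))) :=
  (normalClosure_normal (s := {r})).conj_mem r⁻¹
    ((normalClosure {r}).inv_mem (subset_normalClosure (Set.mem_singleton r))) c

/-- A conjugate of `r^{±1}` lies in the normal closure of `{r}`. -/
theorem conj_bif_mem_normalClosure (c r : SL(2, ZMod 5)) (b : Bool) :
    c * (bif b then r else r⁻¹) * c⁻¹ ∈ normalClosure ({r} : Set (SL(2, ZMod 5))) := by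
  cases b
  · exact conj_inv_mem_normalClosure c r
  · exact conj_mem_normalClosure c r

/-- Every conjugate-product recipe evaluates into the normal closure of `{r}`. -/
theorem prodConj_mem (r : SL(2, ZMod 5)) :
    ∀ ws, prodConj r ws ∈ normalClosure ({r} : Set (SL(2, ZMod 5)))
  | [] => (normalClosure _).one_mem
  | w :: ws => by
    unfold prodConj
    exact (normalClosure _).mul_mem (conj_bif_mem_normalClosure w.1 r w.2) (prodConj_mem r ws)

/-- The witness table lists exactly the representatives. -/
theorem map_fst_ncTable : ncTable.map Prod.fst = reps := by decide +kernel

/-- Kernel check of the normal-closure witnesses: the two recipes of each row evaluate to `x`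
and to `y`. -/
theorem ncTable_check :
    (ncTable.all fun t => decide (prodConj t.1 t.2.1 = x ∧ prodConj t.1 t.2.2 = y)) = true := by
  decide +kernel

/-- The normal closure of each representative contains `x` and `y`, hence is everything. -/
theorem normalClosure_rep_eq_top {r : SL(2, ZMod 5)} (hr : r ∈ reps) :
    normalClosure ({r} : Set (SL(2, ZMod 5))) = ⊤ := by
  have hmem : r ∈ ncTable.map Prod.fst := by rw [map_fst_ncTable]; exact hr
  obtain ⟨t, ht, rfl⟩ := List.mem_map.mp hmem
  obtain ⟨hx, hy⟩ := of_decide_eq_true (List.all_eq_true.mp ncTable_check t ht)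
  exact eq_top_of_mem (hx ▸ prodConj_mem t.1 t.2.1) (hy ▸ prodConj_mem t.1 t.2.2)

/-- The normal closure of ANY non-central element of `SL(2, 𝔽₅)` is everything. -/
theorem normalClosure_singleton_eq_top {g : SL(2, ZMod 5)} (hg : g ∉ center (SL(2, ZMod 5))) :
    normalClosure ({g} : Set (SL(2, ZMod 5))) = ⊤ := by
  obtain ⟨r, hr, hc⟩ := exists_rep_isConj hg
  obtain ⟨c, rfl⟩ := isConj_iff.mp hc
  rw [eq_top_iff, ← normalClosure_rep_eq_top hr]
  refine normalClosure_le_normal ?_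
  intro r' hr'
  rw [Set.mem_singleton_iff] at hr'
  subst hr'
  have h := conj_mem_normalClosure c⁻¹ (c * r' * c⁻¹)
  simpa [mul_assoc] using h

/-- Every normal subgroup of `SL(2, 𝔽₅)` is central or everything; i.e. the proper normal subgroups
are `1` and `{±1}`. -/
theorem normal_le_center_or_eq_top (N : Subgroup (SL(2, ZMod 5))) (hN : N.Normal) :
    N ≤ center (SL(2, ZMod 5)) ∨ N = ⊤ := by
  by_cases h : N ≤ center (SL(2, ZMod 5))
  · exact Or.inl h
  · right
    obtain ⟨g, hgN, hgc⟩ := Set.not_subset.mp h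
    rw [eq_top_iff, ← normalClosure_singleton_eq_top hgc]
    exact normalClosure_le_normal (Set.singleton_subset_iff.mpr hgN)

end BinaryIcosahedral
end Summit.SmoothPoincare4.SmoothPoincare4.Theorems
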